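import Summits.QuantumFields.BalabanUV.T4Continuum.Support.NE7CoordinateLiftWeights
import HarnessLib

/-!
# NE7CoordinateBlockMeanLift — THE ONE-COORDINATE BLOCK-MEAN-EXACT SMOOTH LIFT `clift M λ`: exact block means in direction `λ`, fine differences =
# `O(1/M)` × coarse differences (H¹-stability `144/M²`), L²-stability `36` — every `M ≥ 1`, every `d`, any real normed space

Lineage `b2b-balaban-t4-ne7-p1` (CRUX PROVER NE7 #1 = OWNER of BINDER row NE7), generation 116 — second brick of the UNIFORM UPPER BOUND for the flat-background
effective quadratic form (ROAD-G116 §4(b)∕§6(U): «needs a smooth multilevel right inverse of `levelQ'`»).  On the weights of ✓ `NE7CoordinateLiftWeights`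
(`w₀ w₁ w₂`, block sums `(0, M, 0)`, `|wᵢ| ≤ 2`, `|dwᵢ| ≤ 4/M`), applied in the direction `λ` of `ℤ^d` to a fine-lattice function `F` that is blockwise constant in
that direction (block length `M`, `F y = F (y − (res_M y)_λ e_λ)`):
  `clift M λ F (y) = w₀(s) • F(y − M e_λ) + w₁(s) • F(y) + w₂(s) • F(y + M e_λ)`, `s = (res_M y)_λ`.
WHAT ([folklore]; one def `clift`; 0 sorry):
§2 `clift`: linearity, commutation with real-linear maps of the values (`clift_map`) and with translations `v`, `M ∣ v_λ` (`clift_translate`), periodicity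
   (`clift_per`), blockwise constancy in the other directions (`clift_bconst`), values in a submodule (`clift_mem`); **`sum_clift_line`** (EXACT block means:
   `Σ_{s<M} clift F (y + s e_λ) = M • F y` at block starts);
§3 **`clift_step`**: `clift F (y+e_λ) − clift F (y) = dw₀(s) • (F y − F(y − M e_λ)) + dw₁(s) • (F(y + M e_λ) − F y) + dw₂(s) • (F(y + 2M e_λ) − F(y + M e_λ))`
   (in-block and block-crossing steps in one formula);
§4 **`sum_normSq_step_clift_le`**: `Σ_{y∈[0,P)^d} ‖clift F(y+e_λ) − clift F(y)‖² ≤ (144/M²)·Σ_y ‖F(y + M e_λ) − F(y)‖²` and **`sum_normSq_clift_le`**: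
   `Σ_y ‖clift F y‖² ≤ 36·Σ_y ‖F y‖²` (`F` `P`-periodic).
HONEST FRAMING: pure lattice calculus (kinematics of block averaging); nothing about Bałaban's minimisers; NOT NE7 as a spine node; spine 0∕9; NOT infinite volume,
NOT mass gap, NOT BetaPertH, NOT Clay.
-/

set_option autoImplicit false

open scoped BigOperators
open Finset

namespace Summit.QuantumFields.BalabanUV.T4Continuum.NE7CoordinateBlockMeanLift

open Literature.MathematicalPhysics.QuantumFieldTheory.Balaban1983to89
open B7Prop1Explicit
open T4AveragingDeficitWallBoundary (periodBox mem_periodBox sum_periodBox_shift)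
open SmoothRefineBlocks (blk res blk_add_res res_nonneg res_lt blk_res_eq_of blk_res_add_period res_add_e_self res_add_e_ne)
open NE7CoordinateLiftWeights

noncomputable section

variable {d : ℕ}

/-! ## §2 The lift in one coordinate direction -/

section Lift

variable {X : Type*} [AddCommGroup X] [Module ℝ X]

/-- **THE ONE-COORDINATE LIFT** `clift M λ F (y) = w₀(s) • F(y − M e_λ) + w₁(s) • F(y) + w₂(s) • F(y + M e_λ)`, `s = (res_M y)_λ`. [folklore] -/
def clift (M : ℕ) (lam : Fin d) (F : Site d → X) : Site d → X :=
  fun y => w₀ M (res M y lam) • F (y - (M : ℤ) • e lam) + w₁ M (res M y lam) • F y + w₂ M (res M y lam) • F (y + (M : ℤ) • e lam)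

omit [AddCommGroup X] [Module ℝ X] in
/-- A translation orthogonal to `λ` does not change the offset in direction `λ`. [folklore] -/
theorem res_add_smul_e_ne (M : ℕ) (y : Site d) {lam ν : Fin d} (h : ν ≠ lam) (t : ℤ) : res M (y + t • e ν) lam = res M y lam := by
  simp [res, e_apply, h.symm]

omit [AddCommGroup X] [Module ℝ X] in
/-- A translation by `M e_λ` does not change the offsets. [folklore] -/
theorem res_add_M {M : ℕ} (hM : 1 ≤ M) (y : Site d) (lam : Fin d) : res M (y + (M : ℤ) • e lam) = res M y := by
  simpa using (blk_res_add_period hM y 1 lam).2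

omit [AddCommGroup X] [Module ℝ X] in
/-- A translation by `−M e_λ` does not change the offsets. [folklore] -/
theorem res_sub_M {M : ℕ} (hM : 1 ≤ M) (y : Site d) (lam : Fin d) : res M (y - (M : ℤ) • e lam) = res M y := by
  have h := (blk_res_add_period hM y (-1) lam).2
  simp only [mul_neg, mul_one, neg_smul, ← sub_eq_add_neg] at h
  exact h

omit [AddCommGroup X] [Module ℝ X] in
/-- A translation `v` with `M ∣ v_λ` does not change the offset in direction `λ`. [folklore] -/
theorem res_add_of_dvd (M : ℕ) (y v : Site d) (lam : Fin d) (hv : (M : ℤ) ∣ v lam) : res M (y + v) lam = res M y lam := by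
  obtain ⟨c, hc⟩ := hv
  simp only [res, Pi.add_apply, hc]
  exact Int.add_mul_emod_self_left _ _ _

omit [AddCommGroup X] [Module ℝ X] in
/-- Stepping inside a block from its start: `res (y + s e_λ) = res y + s e_λ` for `res y_λ = 0`, `0 ≤ s < M`. [folklore] -/
theorem res_add_of_start {M : ℕ} (hM : 1 ≤ M) {y : Site d} {lam : Fin d} (hy : res M y lam = 0) {s : ℤ} (h0 : 0 ≤ s) (h1 : s < M) :
    res M (y + s • e lam) = res M y + s • e lam := by
  refine (blk_res_eq_of hM (z := blk M y) ?_ (fun i => ?_) (fun i => ?_)).2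
  · rw [← add_assoc, blk_add_res]
  · simp only [Pi.add_apply, Pi.smul_apply, e_apply, smul_eq_mul]
    split_ifs with hi
    · subst hi; rw [hy]; linarith
    · simp only [mul_zero, add_zero]; exact res_nonneg hM y i
  · simp only [Pi.add_apply, Pi.smul_apply, e_apply, smul_eq_mul]
    split_ifs with hi
    · subst hi; rw [hy]; linarith
    · simp only [mul_zero, add_zero]; exact res_lt hM y i

omit [AddCommGroup X] [Module ℝ X] in
/-- The offset after one unit step in direction `λ`, inside a block. [folklore] -/
theorem res_add_e_of_ne {M : ℕ} (hM : 1 ≤ M) {y : Site d} {lam : Fin d} (h : res M y lam ≠ (M : ℤ) - 1) :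
    res M (y + e lam) lam = res M y lam + 1 := by
  rw [res_add_e_self hM, if_neg h]

omit [AddCommGroup X] [Module ℝ X] in
/-- The offset after the block-crossing unit step in direction `λ`. [folklore] -/
theorem res_add_e_of_eq {M : ℕ} (hM : 1 ≤ M) {y : Site d} {lam : Fin d} (h : res M y lam = (M : ℤ) - 1) :
    res M (y + e lam) lam = 0 := by
  rw [res_add_e_self hM, if_pos h]

omit [AddCommGroup X] [Module ℝ X] in
/-- The block start has offset zero: `res (y − (res y)_ν e_ν)_ν = 0`. [folklore] -/
theorem res_start (M : ℕ) (y : Site d) (ν : Fin d) : res M (y - (res M y ν) • e ν) ν = 0 := by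
  have h : (y - (res M y ν) • e ν) ν = (M : ℤ) * (y ν / (M : ℤ)) := by
    simp [res, e_apply]
    linarith [Int.mul_ediv_add_emod (y ν) (M : ℤ)]
  show (y - (res M y ν) • e ν) ν % (M : ℤ) = 0
  rw [h]
  exact Int.mul_emod_right _ _

omit [AddCommGroup X] [Module ℝ X] in
/-- Two points with the same block start in direction `ν` carry the same value of a function blockwise constant in direction `ν`. [folklore] -/
theorem apply_eq_of_start {M : ℕ} {ν : Fin d} {F : Site d → X} (hF : ∀ y, F y = F (y - (res M y ν) • e ν)) {y y' : Site d}
    (h : y - (res M y ν) • e ν = y' - (res M y' ν) • e ν) : F y = F y' := by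
  rw [hF y, hF y', h]

omit [AddCommGroup X] [Module ℝ X] in
/-- A function blockwise constant in direction `ν` takes the same value along a block read from its start. [folklore] -/
theorem apply_start {M : ℕ} (hM : 1 ≤ M) {ν : Fin d} {F : Site d → X} (hF : ∀ y, F y = F (y - (res M y ν) • e ν)) {y : Site d}
    (hy : res M y ν = 0) {s : ℤ} (h0 : 0 ≤ s) (h1 : s < M) : F (y + s • e ν) = F y := by
  rw [hF (y + s • e ν), res_add_of_start hM hy h0 h1]
  simp [hy, e_apply]

/-- `clift` is subtractive. [folklore] -/
theorem clift_sub (M : ℕ) (lam : Fin d) (F G : Site d → X) : clift M lam (F - G) = clift M lam F - clift M lam G := by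
  funext y
  simp only [clift, Pi.sub_apply, smul_sub]
  abel

/-- `clift` is additive. [folklore] -/
theorem clift_add (M : ℕ) (lam : Fin d) (F G : Site d → X) : clift M lam (F + G) = clift M lam F + clift M lam G := by
  funext y
  simp only [clift, Pi.add_apply, smul_add]
  abel

/-- `clift` commutes with real scalars. [folklore] -/
theorem clift_smul (M : ℕ) (lam : Fin d) (c : ℝ) (F : Site d → X) : clift M lam (c • F) = c • clift M lam F := by
  funext y
  simp only [clift, Pi.smul_apply, smul_add, smul_comm c]

/-- `clift` commutes with every real-linear map of the values. [folklore] -/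
theorem clift_map {Y : Type*} [AddCommGroup Y] [Module ℝ Y] (φ : X →ₗ[ℝ] Y) (M : ℕ) (lam : Fin d) (F : Site d → X) (y : Site d) :
    φ (clift M lam F y) = clift M lam (fun x => φ (F x)) y := by
  simp only [clift, map_add, map_smul]

/-- **`clift` commutes with the translations `v` with `M ∣ v_λ`** (all translations orthogonal to `λ`, and the coarse translations along `λ`). [folklore] -/
theorem clift_translate (M : ℕ) (lam : Fin d) (F : Site d → X) (v : Site d) (hv : (M : ℤ) ∣ v lam) :
    clift M lam (fun y => F (y + v)) = fun y => clift M lam F (y + v) := by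
  funext y
  simp only [clift]
  rw [res_add_of_dvd M y v lam hv, add_sub_right_comm y v, add_right_comm y v]

/-- `clift` preserves periodicity `P` with `M ∣ P`. [folklore] -/
theorem clift_per {M : ℕ} {P : ℤ} (hMP : (M : ℤ) ∣ P) (lam : Fin d) {F : Site d → X} (hF : ∀ (y : Site d) (κ : Fin d), F (y + P • e κ) = F y)
    (y : Site d) (κ : Fin d) : clift M lam F (y + P • e κ) = clift M lam F y := by
  have hv : (M : ℤ) ∣ (P • e κ) lam := by
    simp only [Pi.smul_apply, e_apply, smul_eq_mul]
    split_ifs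
    · simpa using hMP
    · simp
  have hFv : (fun y => F (y + P • e κ)) = F := funext fun y => hF y κ
  have h := congr_fun (clift_translate M lam F (P • e κ) hv) y
  rw [hFv] at h
  exact h.symm

/-- `clift` in direction `λ` preserves blockwise constancy in every other direction `ν`. [folklore] -/
theorem clift_bconst {M : ℕ} {lam ν : Fin d} (hne : ν ≠ lam) {F : Site d → X} (hF : ∀ y, F y = F (y - (res M y ν) • e ν)) (y : Site d) :
    clift M lam F y = clift M lam F (y - (res M y ν) • e ν) := by
  have hsub : ∀ r : ℤ, y - r • e ν = y + (-r) • e ν := fun r => by rw [neg_smul, sub_eq_add_neg]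
  have hr : res M (y - (res M y ν) • e ν) lam = res M y lam := by rw [hsub, res_add_smul_e_ne M y hne]
  have h0 : res M (y - (res M y ν) • e ν) ν = 0 := res_start M y ν
  have key : ∀ w : Site d, w ν = 0 → F (y + w) = F (y - (res M y ν) • e ν + w) := by
    intro w hw
    refine apply_eq_of_start hF ?_
    have h1 : res M (y + w) ν = res M y ν := by
      simp [res, hw]
    have h2 : res M (y - (res M y ν) • e ν + w) ν = 0 := by
      have : res M (y - (res M y ν) • e ν + w) ν = res M (y - (res M y ν) • e ν) ν := by simp [res, hw]
      rw [this, h0]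
    rw [h1, h2, zero_smul, sub_zero]
    abel
  have hν : ((M : ℤ) • e lam) ν = 0 := by simp [e_apply, hne]
  have hν' : (-((M : ℤ) • e lam)) ν = 0 := by simp [e_apply, hne]
  have hA : F (y - (M : ℤ) • e lam) = F (y - (res M y ν) • e ν - (M : ℤ) • e lam) := by
    have h := key _ hν'
    simp only [← sub_eq_add_neg] at h
    exact h
  have hB : F y = F (y - (res M y ν) • e ν) := by simpa using key 0 (by simp)
  have hC : F (y + (M : ℤ) • e lam) = F (y - (res M y ν) • e ν + (M : ℤ) • e lam) := key _ hν
  simp only [clift, hr]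
  rw [← hA, ← hB, ← hC]

/-- `clift` preserves values in a submodule. [folklore] -/
theorem clift_mem (K : Submodule ℝ X) (M : ℕ) (lam : Fin d) {F : Site d → X} (hF : ∀ y, F y ∈ K) (y : Site d) : clift M lam F y ∈ K :=
  K.add_mem (K.add_mem (K.smul_mem _ (hF _)) (K.smul_mem _ (hF _))) (K.smul_mem _ (hF _))

/-- **EXACT BLOCK MEANS**: at a block start `y` (`res y_λ = 0`) of a function blockwise constant in direction `λ` (`M ≥ 1`),
`Σ_{s<M} clift F (y + s e_λ) = M • F y`. [folklore] -/
theorem sum_clift_line {M : ℕ} (hM : 1 ≤ M) (lam : Fin d) {F : Site d → X} (hF : ∀ y, F y = F (y - (res M y lam) • e lam)) {y : Site d}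
    (hy : res M y lam = 0) : ∑ s ∈ range M, clift M lam F (y + (s : ℤ) • e lam) = (M : ℝ) • F y := by
  have hres : ∀ s ∈ range M, res M (y + (s : ℤ) • e lam) lam = s := fun s hs => by
    rw [res_add_of_start hM hy (by positivity) (by exact_mod_cast Finset.mem_range.mp hs)]
    simp [hy, e_apply]
  have hs' : ∀ s ∈ range M, (0 : ℤ) ≤ s ∧ (s : ℤ) < M := fun s hs => ⟨by positivity, by exact_mod_cast Finset.mem_range.mp hs⟩
  have hyp : res M (y + (M : ℤ) • e lam) lam = 0 := by rw [res_add_M hM]; exact hy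
  have hym : res M (y - (M : ℤ) • e lam) lam = 0 := by rw [res_sub_M hM]; exact hy
  have hF0 : ∀ s ∈ range M, F (y + (s : ℤ) • e lam) = F y := fun s hs => apply_start hM hF hy (hs' s hs).1 (hs' s hs).2
  have hFp : ∀ s ∈ range M, F (y + (s : ℤ) • e lam + (M : ℤ) • e lam) = F (y + (M : ℤ) • e lam) := fun s hs => by
    rw [add_right_comm]; exact apply_start hM hF hyp (hs' s hs).1 (hs' s hs).2
  have hFm : ∀ s ∈ range M, F (y + (s : ℤ) • e lam - (M : ℤ) • e lam) = F (y - (M : ℤ) • e lam) := fun s hs => by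
    rw [show y + (s : ℤ) • e lam - (M : ℤ) • e lam = y - (M : ℤ) • e lam + (s : ℤ) • e lam by abel]
    exact apply_start hM hF hym (hs' s hs).1 (hs' s hs).2
  calc ∑ s ∈ range M, clift M lam F (y + (s : ℤ) • e lam)
      = ∑ s ∈ range M, (w₀ M s • F (y - (M : ℤ) • e lam) + w₁ M s • F y + w₂ M s • F (y + (M : ℤ) • e lam)) := by
        refine Finset.sum_congr rfl fun s hs => ?_
        simp only [clift, hres s hs, hF0 s hs, hFp s hs, hFm s hs]
    _ = (∑ s ∈ range M, w₀ M s) • F (y - (M : ℤ) • e lam) + (∑ s ∈ range M, w₁ M s) • F y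
          + (∑ s ∈ range M, w₂ M s) • F (y + (M : ℤ) • e lam) := by
        rw [Finset.sum_add_distrib, Finset.sum_add_distrib, Finset.sum_smul, Finset.sum_smul, Finset.sum_smul]
    _ = (M : ℝ) • F y := by rw [sum_range_w₀ hM, sum_range_w₁, sum_range_w₂ hM, zero_smul, zero_smul, zero_add, add_zero]

/-! ## §3 The fine difference of the lift: `O(1/M)` × coarse differences -/

/-- **THE STEP FORMULA**: for `F` blockwise constant in direction `λ` (`M ≥ 1`), with `s = (res_M y)_λ`,
`clift F (y + e_λ) − clift F (y) = dw₀(s) • (F y − F(y − M e_λ)) + dw₁(s) • (F(y + M e_λ) − F y) + dw₂(s) • (F(y + M e_λ + M e_λ) − F(y + M e_λ))`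
— in-block steps and the block-crossing step alike. [folklore] -/
theorem clift_step {M : ℕ} (hM : 1 ≤ M) (lam : Fin d) {F : Site d → X} (hF : ∀ y, F y = F (y - (res M y lam) • e lam)) (y : Site d) :
    clift M lam F (y + e lam) - clift M lam F y
      = dw₀ M (res M y lam) • (F y - F (y - (M : ℤ) • e lam)) + dw₁ M (res M y lam) • (F (y + (M : ℤ) • e lam) - F y)
        + dw₂ M (res M y lam) • (F (y + (M : ℤ) • e lam + (M : ℤ) • e lam) - F (y + (M : ℤ) • e lam)) := by
  by_cases hc : res M y lam = (M : ℤ) - 1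
  · -- the block-crossing step
    have h0 : res M (y + e lam) lam = 0 := res_add_e_of_eq hM hc
    have hA : F (y + e lam - (M : ℤ) • e lam) = F y := by
      refine apply_eq_of_start hF ?_
      rw [res_sub_M hM, h0, hc]
      module
    have hB : F (y + e lam) = F (y + (M : ℤ) • e lam) := by
      refine apply_eq_of_start hF ?_
      rw [h0, res_add_M hM, hc]
      module
    have hC : F (y + e lam + (M : ℤ) • e lam) = F (y + (M : ℤ) • e lam + (M : ℤ) • e lam) := by
      refine apply_eq_of_start hF ?_
      rw [res_add_M hM, h0, res_add_M hM, res_add_M hM, hc]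
      module
    have e1 : w₁ M 0 = 1 - w₀ M 0 - w₂ M 0 := by linarith [w_sum M 0]
    have e2 : w₁ M ((M : ℤ) - 1) = 1 - w₀ M ((M : ℤ) - 1) - w₂ M ((M : ℤ) - 1) := by linarith [w_sum M ((M : ℤ) - 1)]
    simp only [clift, h0, hc, hA, hB, hC, dw₀, dw₁, dw₂, if_true]
    rw [e1, e2]
    module
  · -- an in-block step
    have h1 : res M (y + e lam) lam = res M y lam + 1 := res_add_e_of_ne hM hc
    have hA : F (y + e lam - (M : ℤ) • e lam) = F (y - (M : ℤ) • e lam) := by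
      refine apply_eq_of_start hF ?_
      rw [res_sub_M hM, h1, res_sub_M hM]
      module
    have hB : F (y + e lam) = F y := by
      refine apply_eq_of_start hF ?_
      rw [h1]
      module
    have hC : F (y + e lam + (M : ℤ) • e lam) = F (y + (M : ℤ) • e lam) := by
      refine apply_eq_of_start hF ?_
      rw [res_add_M hM, h1, res_add_M hM]
      module
    have e1 : w₁ M (res M y lam + 1) = 1 - w₀ M (res M y lam + 1) - w₂ M (res M y lam + 1) := by linarith [w_sum M (res M y lam + 1)]
    have e2 : w₁ M (res M y lam) = 1 - w₀ M (res M y lam) - w₂ M (res M y lam) := by linarith [w_sum M (res M y lam)]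
    simp only [clift, h1, hc, hA, hB, hC, dw₀, dw₁, dw₂, if_false]
    rw [e1, e2]
    module

end Lift

/-! ## §4 The two energy estimates -/

section Energy

variable {X : Type*} [NormedAddCommGroup X] [NormedSpace ℝ X]

/-- A weighted three-term combination: `‖a•A + b•B + c•C‖² ≤ 3K²(‖A‖² + ‖B‖² + ‖C‖²)` for `|a|,|b|,|c| ≤ K`. [folklore] -/
theorem normSq_three_le {a b c K : ℝ} (ha : |a| ≤ K) (hb : |b| ≤ K) (hc : |c| ≤ K) (A B C : X) :
    ‖a • A + b • B + c • C‖ ^ 2 ≤ 3 * K ^ 2 * (‖A‖ ^ 2 + ‖B‖ ^ 2 + ‖C‖ ^ 2) := by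
  have hK : 0 ≤ K := (abs_nonneg a).trans ha
  have h1 : ‖a • A + b • B + c • C‖ ≤ K * ‖A‖ + K * ‖B‖ + K * ‖C‖ := by
    calc ‖a • A + b • B + c • C‖ ≤ ‖a • A‖ + ‖b • B‖ + ‖c • C‖ := norm_add₃_le
      _ = |a| * ‖A‖ + |b| * ‖B‖ + |c| * ‖C‖ := by rw [norm_smul, norm_smul, norm_smul, Real.norm_eq_abs, Real.norm_eq_abs, Real.norm_eq_abs]
      _ ≤ K * ‖A‖ + K * ‖B‖ + K * ‖C‖ := by gcongr
  have h2 : (K * ‖A‖ + K * ‖B‖ + K * ‖C‖) ^ 2 ≤ 3 * K ^ 2 * (‖A‖ ^ 2 + ‖B‖ ^ 2 + ‖C‖ ^ 2) := by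
    have : (‖A‖ + ‖B‖ + ‖C‖) ^ 2 ≤ 3 * (‖A‖ ^ 2 + ‖B‖ ^ 2 + ‖C‖ ^ 2) := by
      nlinarith [sq_nonneg (‖A‖ - ‖B‖), sq_nonneg (‖B‖ - ‖C‖), sq_nonneg (‖A‖ - ‖C‖)]
    nlinarith [sq_nonneg K]
  calc ‖a • A + b • B + c • C‖ ^ 2 ≤ (K * ‖A‖ + K * ‖B‖ + K * ‖C‖) ^ 2 := by gcongr
    _ ≤ _ := h2

/-- **L²-STABILITY**: `Σ_{y∈[0,P)^d} ‖clift F y‖² ≤ 36·Σ_y ‖F y‖²` for `F` `P`-periodic, `M ≥ 1`. [folklore] -/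
theorem sum_normSq_clift_le {M P : ℕ} (hM : 1 ≤ M) (hP : 1 ≤ P) (lam : Fin d) {F : Site d → X}
    (hFP : ∀ (y : Site d) (κ : Fin d), F (y + (P : ℤ) • e κ) = F y) :
    ∑ y ∈ periodBox (d := d) P, ‖clift M lam F y‖ ^ 2 ≤ 36 * ∑ y ∈ periodBox (d := d) P, ‖F y‖ ^ 2 := by
  have hpt : ∀ y : Site d, ‖clift M lam F y‖ ^ 2 ≤ 12 * (‖F (y - (M : ℤ) • e lam)‖ ^ 2 + ‖F y‖ ^ 2 + ‖F (y + (M : ℤ) • e lam)‖ ^ 2) := by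
    intro y
    obtain ⟨h0, h1, h2⟩ := abs_w_le (M := M) (res_nonneg hM y lam) (res_lt hM y lam)
    have := normSq_three_le h0 h1 h2 (F (y - (M : ℤ) • e lam)) (F y) (F (y + (M : ℤ) • e lam))
    simp only [clift]
    linarith
  have hg : ∀ (x : Site d) (κ : Fin d), (fun y => ‖F y‖ ^ 2) (x + (P : ℤ) • e κ) = (fun y => ‖F y‖ ^ 2) x := fun x κ => by simp only [hFP]
  have hSm : ∑ y ∈ periodBox (d := d) P, ‖F (y - (M : ℤ) • e lam)‖ ^ 2 = ∑ y ∈ periodBox (d := d) P, ‖F y‖ ^ 2 := by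
    simpa only [sub_eq_add_neg] using sum_periodBox_shift P hP (g := fun y => ‖F y‖ ^ 2) hg (-((M : ℤ) • e lam))
  have hSp : ∑ y ∈ periodBox (d := d) P, ‖F (y + (M : ℤ) • e lam)‖ ^ 2 = ∑ y ∈ periodBox (d := d) P, ‖F y‖ ^ 2 :=
    sum_periodBox_shift P hP (g := fun y => ‖F y‖ ^ 2) hg ((M : ℤ) • e lam)
  calc ∑ y ∈ periodBox (d := d) P, ‖clift M lam F y‖ ^ 2
      ≤ ∑ y ∈ periodBox (d := d) P, 12 * (‖F (y - (M : ℤ) • e lam)‖ ^ 2 + ‖F y‖ ^ 2 + ‖F (y + (M : ℤ) • e lam)‖ ^ 2) :=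
        Finset.sum_le_sum fun y _ => hpt y
    _ = 36 * ∑ y ∈ periodBox (d := d) P, ‖F y‖ ^ 2 := by
        rw [← Finset.mul_sum, Finset.sum_add_distrib, Finset.sum_add_distrib, hSm, hSp]; ring

/-- **H¹-STABILITY**: for `F` `P`-periodic (`M ∣ P`, `M ≥ 1`) and blockwise constant in direction `λ`,
`Σ_{y∈[0,P)^d} ‖clift F (y + e_λ) − clift F y‖² ≤ (144/M²)·Σ_y ‖F(y + M e_λ) − F y‖²` — the fine differences of the lift are `O(1/M)` times the coarse
differences of the datum. [folklore] -/
theorem sum_normSq_step_clift_le {M P : ℕ} (hM : 1 ≤ M) (hP : 1 ≤ P) (lam : Fin d) {F : Site d → X}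
    (hFP : ∀ (y : Site d) (κ : Fin d), F (y + (P : ℤ) • e κ) = F y) (hF : ∀ y, F y = F (y - (res M y lam) • e lam)) :
    ∑ y ∈ periodBox (d := d) P, ‖clift M lam F (y + e lam) - clift M lam F y‖ ^ 2
      ≤ 144 * (1 / (M : ℝ)) ^ 2 * ∑ y ∈ periodBox (d := d) P, ‖F (y + (M : ℤ) • e lam) - F y‖ ^ 2 := by
  set g : Site d → ℝ := fun y => ‖F (y + (M : ℤ) • e lam) - F y‖ ^ 2 with hgdef
  have hpt : ∀ y : Site d, ‖clift M lam F (y + e lam) - clift M lam F y‖ ^ 2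
      ≤ 48 * (1 / (M : ℝ)) ^ 2 * (g (y - (M : ℤ) • e lam) + g y + g (y + (M : ℤ) • e lam)) := by
    intro y
    obtain ⟨h0, h1, h2⟩ := abs_dw_le hM (res_nonneg hM y lam) (res_lt hM y lam)
    have := normSq_three_le h0 h1 h2 (F y - F (y - (M : ℤ) • e lam)) (F (y + (M : ℤ) • e lam) - F y)
      (F (y + (M : ℤ) • e lam + (M : ℤ) • e lam) - F (y + (M : ℤ) • e lam))
    rw [clift_step hM lam hF y]
    have hg0 : g (y - (M : ℤ) • e lam) = ‖F y - F (y - (M : ℤ) • e lam)‖ ^ 2 := by simp only [hgdef, sub_add_cancel]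
    rw [hg0]
    simp only [hgdef]
    linarith
  have hg : ∀ (x : Site d) (κ : Fin d), g (x + (P : ℤ) • e κ) = g x := fun x κ => by
    simp only [hgdef, add_right_comm x _ ((M : ℤ) • e lam), hFP]
  have hSm : ∑ y ∈ periodBox (d := d) P, g (y - (M : ℤ) • e lam) = ∑ y ∈ periodBox (d := d) P, g y := by
    simpa only [sub_eq_add_neg] using sum_periodBox_shift P hP hg (-((M : ℤ) • e lam))
  have hSp : ∑ y ∈ periodBox (d := d) P, g (y + (M : ℤ) • e lam) = ∑ y ∈ periodBox (d := d) P, g y :=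
    sum_periodBox_shift P hP hg ((M : ℤ) • e lam)
  calc ∑ y ∈ periodBox (d := d) P, ‖clift M lam F (y + e lam) - clift M lam F y‖ ^ 2
      ≤ ∑ y ∈ periodBox (d := d) P, 48 * (1 / (M : ℝ)) ^ 2 * (g (y - (M : ℤ) • e lam) + g y + g (y + (M : ℤ) • e lam)) :=
        Finset.sum_le_sum fun y _ => hpt y
    _ = 144 * (1 / (M : ℝ)) ^ 2 * ∑ y ∈ periodBox (d := d) P, g y := by
        rw [← Finset.mul_sum, Finset.sum_add_distrib, Finset.sum_add_distrib, hSm, hSp]; ring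

end Energy

end

end Summit.QuantumFields.BalabanUV.T4Continuum.NE7CoordinateBlockMeanLift
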